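import Summits.Ventures.PercRepro.RankLevelSetDepCountGiantB
import Summits.Ventures.PercRepro.RankLevelSetCorankFiveCounts

/-!
# PercRepro — THE HEAVY / LIGHT SPLIT OF THE `U`-COUNT BY THE NULLITY OF THE CLOSURE, PART A: THE UNION LEMMA (p8, S3)

`proofs/SUBCLAIM-S3-p8.md` §3f. The pair count of the level-`q` `U`-count charges every pair `(C, B′)` the fibre of a
closure with the MAXIMAL number of points. Here the pairs are split by the NULLITY `ν(F) = |F| − r(F)` of the closure
`F = cl(C ∪ B′)`: the LIGHT pairs (`ν(F) ≤ ν₁ − 1`) have a fibre over `≤ ν₁ − 2` free points, and the HEAVY rank-`q` sets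
(`ν(cl B) ≥ ν₁`) lie inside a SMALL union of flats. The structural facts, for a matroid of corank `d` in which sets of
rank `≤ ρ − j − 1` have nullity `≤ cj` and `d + cj + 1 ≤ 2ν₁`:
* `eRk_inter_ge_of_heavy` — two rank-`ρ` sets of nullity `≥ ν₁` meet in rank `≥ ρ − j` (supermodularity of the
  nullity: `ν(F ∩ F′) ≥ ν(F) + ν(F′) − ν(F ∪ F′) ≥ 2ν₁ − d > cj`);
* `ncard_add_le_of_ssubset_good` — a proper subset `S` of a GOOD heavy rank-`q` flat `F` (one that is not
  `insert x H` for a rank-`(q−1)` flat `H` of nullity `≥ ν₁`) loses nullity: `ν(S) + 1 ≤ ν(F)`;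
  `ncard_add_le_of_ssubset_hfam` — the same for a rank-`(q−1)` flat of nullity `≥ ν₁`;
* **`union_bound`** — for a finite family `𝓕` of rank-`ρ` flats of nullity `≥ ν₁`, pairwise meeting in rank
  `≥ ρ − j` and each losing nullity on proper subsets: `(j + 1)·r(⋃𝓕) + j·ν₁ ≤ ρ + j·|⋃𝓕|` (Finset induction: a
  new flat `F ⊄ U′` meets `U′` in rank `≥ ρ − j` and in nullity `≤ ν(F) − 1`), whence `|⋃𝓕| ≤ ρ + (j + 1)d − j·ν₁`
  (`ncard_biUnion_le_of_heavy`).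
Axioms: standard.
-/

open scoped Matroid

namespace PercRepro

namespace Matroid

open Set Finset

variable {α : Type} {M : _root_.Matroid α}

/-- The corank cap in `ℕ`: `|X| ≤ r(X) + d` for `X ⊆ E`. -/
theorem ncard_le_add_of_eRk_eq [M.Finite] {X : Set α} (hX : X ⊆ M.E) {d : ℕ}
    (hd : M.E.encard = M.eRank + d) {r : ℕ} (hr : M.eRk X = r) : X.ncard ≤ r + d := by
  have h1 := encard_le_eRk_add_of_encard_eq (M := M) hX hd
  have hfin : X.Finite := M.ground_finite.subset hX
  rw [hr, ← hfin.cast_ncard_eq] at h1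
  exact_mod_cast h1

/-- `r(X) ≤ |X|` in `ℕ`. -/
theorem le_ncard_of_eRk_eq [M.Finite] {X : Set α} (hX : X ⊆ M.E) {r : ℕ} (hr : M.eRk X = r) :
    r ≤ X.ncard := by
  have h := M.eRk_le_encard X
  have hfin : X.Finite := M.ground_finite.subset hX
  rw [hr, ← hfin.cast_ncard_eq] at h
  exact_mod_cast h

/-- **(a) Two rank-`ρ` sets of nullity `≥ ν₁` meet in rank `≥ ρ − j`** when every set of rank `≤ ρ − j − 1` has
nullity `≤ cj` and `d + cj + 1 ≤ 2ν₁`. -/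
theorem eRk_inter_ge_of_heavy [M.Finite] {ρ ν₁ j cj d : ℕ} (hd : M.E.encard = M.eRank + d)
    (hcj : ∀ X ⊆ M.E, M.eRk X ≤ ((ρ - j - 1 : ℕ) : ℕ∞) → (X.ncard : ℕ∞) ≤ M.eRk X + cj)
    (hν : d + cj + 1 ≤ 2 * ν₁)
    {F F' : Set α} (hF : F ⊆ M.E) (hF' : F' ⊆ M.E) (hrF : M.eRk F = ρ) (hrF' : M.eRk F' = ρ)
    (hνF : ρ + ν₁ ≤ F.ncard) (hνF' : ρ + ν₁ ≤ F'.ncard) :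
    ((ρ - j : ℕ) : ℕ∞) ≤ M.eRk (F ∩ F') := by
  have hFfin : F.Finite := M.ground_finite.subset hF
  have hF'fin : F'.Finite := M.ground_finite.subset hF'
  have hIE : F ∩ F' ⊆ M.E := inter_subset_left.trans hF
  have hUE : F ∪ F' ⊆ M.E := union_subset hF hF'
  obtain ⟨a, ha⟩ := exists_eRk_eq_nat (M := M) hIE
  obtain ⟨b, hb⟩ := exists_eRk_eq_nat (M := M) hUE
  have hsub := M.eRk_inter_add_eRk_union_le F F'
  rw [ha, hb, hrF, hrF'] at hsub
  have hsub' : a + b ≤ ρ + ρ := by exact_mod_cast hsub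
  have hcap : (F ∪ F').ncard ≤ b + d := ncard_le_add_of_eRk_eq hUE hd hb
  have hsum := Set.ncard_union_add_ncard_inter F F' hFfin hF'fin
  rw [ha]
  by_contra hcon
  push Not at hcon
  have hlt : a < ρ - j := by exact_mod_cast hcon
  have hale : M.eRk (F ∩ F') ≤ ((ρ - j - 1 : ℕ) : ℕ∞) := by
    rw [ha]; exact_mod_cast (by omega : a ≤ ρ - j - 1)
  have hsmall := hcj (F ∩ F') hIE hale
  rw [ha] at hsmall
  have hsmall' : (F ∩ F').ncard ≤ a + cj := by exact_mod_cast hsmall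
  omega

/-- **(b) A proper subset of a GOOD heavy rank-`q` flat loses nullity**: `|S| + q + 1 ≤ |F| + r(S)`, i.e.
`ν(S) + 1 ≤ ν(F)`. `F` is GOOD when it is not `insert x H` for a rank-`(q−1)` flat `H` of nullity `≥ ν₁`. -/
theorem ncard_add_le_of_ssubset_good [M.Finite] {q ν₁ c : ℕ} (hq : 2 ≤ q)
    (hc : ∀ X ⊆ M.E, M.eRk X ≤ ((q - 2 : ℕ) : ℕ∞) → (X.ncard : ℕ∞) ≤ M.eRk X + c)
    (hν : c + 1 ≤ ν₁)
    {F : Set α} (hF : F ⊆ M.E) (hFc : M.closure F = F) (hrF : M.eRk F = q) (hνF : q + ν₁ ≤ F.ncard)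
    (hgood : ∀ H : Set α, H ⊆ M.E → M.closure H = H → M.eRk H = ((q - 1 : ℕ) : ℕ∞) →
      q - 1 + ν₁ ≤ H.ncard → ∀ x, F ≠ insert x H)
    {S : Set α} (hS : S ⊆ F) (hSF : S ≠ F) {r : ℕ} (hr : M.eRk S = r) :
    S.ncard + q + 1 ≤ F.ncard + r := by
  have hFfin : F.Finite := M.ground_finite.subset hF
  have hSE : S ⊆ M.E := hS.trans hF
  have hrq : r ≤ q := by
    have := M.eRk_mono hS
    rw [hr, hrF] at this
    exact_mod_cast this
  have hSlt : S.ncard < F.ncard := Set.ncard_lt_ncard (LE.le.ssubset_of_ne hS hSF) hFfin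
  rcases Nat.lt_or_ge r (q - 1) with hlt | hge
  · -- `r ≤ q − 2`
    have h1 := hc S hSE (by rw [hr]; exact_mod_cast (by omega : r ≤ q - 2))
    rw [hr] at h1
    have h1' : S.ncard ≤ r + c := by exact_mod_cast h1
    omega
  · rcases Nat.lt_or_ge r q with hlt2 | hge2
    · -- `r = q − 1`: the flat `H = cl S` has rank `q − 1`
      have hrq1 : r = q - 1 := by omega
      set H := M.closure S with hHdef
      have hHE : H ⊆ M.E := M.closure_subset_ground S
      have hHF : H ⊆ F := by rw [← hFc]; exact M.closure_subset_closure hS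
      have hHc : M.closure H = H := M.closure_closure S
      have hrH : M.eRk H = ((q - 1 : ℕ) : ℕ∞) := by rw [hHdef, M.eRk_closure_eq, hr, hrq1]
      have hSH : S ⊆ H := M.subset_closure S hSE
      have hHfin : H.Finite := hFfin.subset hHF
      have hSHcard : S.ncard ≤ H.ncard := ncard_le_ncard hSH hHfin
      by_cases hbig : q - 1 + ν₁ ≤ H.ncard
      · -- `H` is a heavy rank-`(q−1)` flat: `F ≠ insert x H`, so `F` has `≥ 2` points outside `H`
        have hne : H ≠ F := by
          intro h
          rw [h, hrF] at hrH
          have : q = q - 1 := by exact_mod_cast hrH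
          omega
        have hdiff : 2 ≤ (F \ H).ncard := by
          by_contra hcon
          push Not at hcon
          have hpos : (F \ H).Nonempty := by
            rw [Set.nonempty_iff_ne_empty, Ne, Set.sdiff_eq_empty]
            intro hFH
            exact hne (Set.Subset.antisymm hHF hFH)
          obtain ⟨x, hx⟩ := hpos
          have hone : F \ H = {x} := by
            have h1 : (F \ H).ncard ≤ 1 := by omega
            rw [Set.ncard_le_one_iff (hFfin.subset Set.sdiff_subset)] at h1
            ext y
            constructor
            · intro hy
              exact Set.mem_singleton_iff.2 (h1 hy hx)
            · intro hy
              rw [Set.mem_singleton_iff] at hy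
              rw [hy]
              exact hx
          apply hgood H hHE hHc hrH hbig x
          rw [← Set.sdiff_union_of_subset hHF, hone, Set.singleton_union]
        have h3 := Set.ncard_sdiff hHF hHfin
        omega
      · push Not at hbig
        omega
    · -- `r = q`
      have hrq' : r = q := by omega
      omega

/-- **(b′) A proper subset of a rank-`(q−1)` flat of nullity `≥ ν₁` loses nullity**:
`|S| + (q − 1) + 1 ≤ |H| + r(S)`. -/
theorem ncard_add_le_of_ssubset_hfam [M.Finite] {q ν₁ c : ℕ} (hq : 2 ≤ q)
    (hc : ∀ X ⊆ M.E, M.eRk X ≤ ((q - 2 : ℕ) : ℕ∞) → (X.ncard : ℕ∞) ≤ M.eRk X + c)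
    (hν : c + 1 ≤ ν₁)
    {H : Set α} (hH : H ⊆ M.E) (hrH : M.eRk H = ((q - 1 : ℕ) : ℕ∞)) (hνH : q - 1 + ν₁ ≤ H.ncard)
    {S : Set α} (hS : S ⊆ H) (hSH : S ≠ H) {r : ℕ} (hr : M.eRk S = r) :
    S.ncard + (q - 1) + 1 ≤ H.ncard + r := by
  have hHfin : H.Finite := M.ground_finite.subset hH
  have hSE : S ⊆ M.E := hS.trans hH
  have hrq : r ≤ q - 1 := by
    have := M.eRk_mono hS
    rw [hr, hrH] at this
    exact_mod_cast this
  have hSlt : S.ncard < H.ncard := Set.ncard_lt_ncard (LE.le.ssubset_of_ne hS hSH) hHfin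
  rcases Nat.lt_or_ge r (q - 1) with hlt | hge
  · have h1 := hc S hSE (by rw [hr]; exact_mod_cast (by omega : r ≤ q - 2))
    rw [hr] at h1
    have h1' : S.ncard ≤ r + c := by exact_mod_cast h1
    omega
  · have hrq' : r = q - 1 := by omega
    omega

/-- **The union lemma.** For a nonempty finite family `𝓕` of rank-`ρ` sets of nullity `≥ ν₁` (`|F| ≥ ρ + ν₁`),
pairwise meeting in rank `≥ ρ − j`, each losing nullity on proper subsets (`|S| + ρ + 1 ≤ |F| + r(S)` for `S ⊊ F`):
`(j + 1)·r(⋃𝓕) + j·ν₁ ≤ ρ + j·|⋃𝓕|`. -/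
theorem union_bound [M.Finite] {ρ ν₁ j : ℕ} (𝓕 : Finset (Set α)) (hne : 𝓕.Nonempty)
    (hFE : ∀ F ∈ 𝓕, F ⊆ M.E) (hrk : ∀ F ∈ 𝓕, M.eRk F = ρ) (hν : ∀ F ∈ 𝓕, ρ + ν₁ ≤ F.ncard)
    (hinter : ∀ F ∈ 𝓕, ∀ F' ∈ 𝓕, F ≠ F' → ((ρ - j : ℕ) : ℕ∞) ≤ M.eRk (F ∩ F'))
    (hsub : ∀ F ∈ 𝓕, ∀ S ⊆ F, S ≠ F → ∀ r : ℕ, M.eRk S = r → S.ncard + ρ + 1 ≤ F.ncard + r)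
    {r : ℕ} (hr : M.eRk (⋃ F ∈ 𝓕, F) = r) :
    (j + 1) * r + j * ν₁ ≤ ρ + j * (⋃ F ∈ 𝓕, F).ncard := by
  classical
  induction 𝓕 using Finset.induction_on generalizing r with
  | empty => exact absurd hne Finset.not_nonempty_empty
  | insert F 𝓕' hF ih =>
    rw [Finset.set_biUnion_insert] at hr ⊢
    have hFE' : F ⊆ M.E := hFE F (Finset.mem_insert_self F 𝓕')
    have hrF : M.eRk F = ρ := hrk F (Finset.mem_insert_self F 𝓕')
    have hνF : ρ + ν₁ ≤ F.ncard := hν F (Finset.mem_insert_self F 𝓕')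
    by_cases h𝓕' : 𝓕'.Nonempty
    · set U' := ⋃ G ∈ 𝓕', G with hU'
      have hU'E : U' ⊆ M.E := by
        intro x hx
        rw [hU', Set.mem_iUnion₂] at hx
        obtain ⟨G, hG, hxG⟩ := hx
        exact hFE G (Finset.mem_insert_of_mem hG) hxG
      obtain ⟨r', hr'⟩ := exists_eRk_eq_nat (M := M) hU'E
      have ih' := ih h𝓕' (fun G hG => hFE G (Finset.mem_insert_of_mem hG))
        (fun G hG => hrk G (Finset.mem_insert_of_mem hG))
        (fun G hG => hν G (Finset.mem_insert_of_mem hG))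
        (fun G hG G' hG' hne' => hinter G (Finset.mem_insert_of_mem hG) G' (Finset.mem_insert_of_mem hG') hne')
        (fun G hG => hsub G (Finset.mem_insert_of_mem hG)) hr'
      by_cases hFU : F ⊆ U'
      · rw [Set.union_eq_right.2 hFU] at hr ⊢
        rw [hr] at hr'
        have : r = r' := by exact_mod_cast hr'
        rw [← this] at ih'
        exact ih'
      · set S := F ∩ U' with hSdef
        have hSE : S ⊆ M.E := inter_subset_left.trans hFE'
        obtain ⟨s, hs⟩ := exists_eRk_eq_nat (M := M) hSE
        have hSF : S ≠ F := fun h => hFU (by rw [← h]; exact inter_subset_right)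
        have hsubS := hsub F (Finset.mem_insert_self F 𝓕') S inter_subset_left hSF s hs
        obtain ⟨F', hF'⟩ := h𝓕'
        have hFF' : F ≠ F' := fun h => hF (h ▸ hF')
        have hi := hinter F (Finset.mem_insert_self F 𝓕') F' (Finset.mem_insert_of_mem hF') hFF'
        have hF'U : F' ⊆ U' := by
          intro x hx
          rw [hU', Set.mem_iUnion₂]
          exact ⟨F', hF', hx⟩
        have hsge : ρ - j ≤ s := by
          have h1 : M.eRk (F ∩ F') ≤ M.eRk S := M.eRk_mono (Set.inter_subset_inter_right F hF'U)
          have := hi.trans h1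
          rw [hs] at this
          exact_mod_cast this
        have hsle : s ≤ ρ := by
          have := M.eRk_mono (inter_subset_left : S ⊆ F)
          rw [hs, hrF] at this
          exact_mod_cast this
        have hsm := M.eRk_inter_add_eRk_union_le F U'
        rw [hs, hr, hrF, hr'] at hsm
        have hsm' : s + r ≤ ρ + r' := by exact_mod_cast hsm
        have hFfin : F.Finite := M.ground_finite.subset hFE'
        have hU'fin : U'.Finite := M.ground_finite.subset hU'E
        have hie := Set.ncard_union_add_ncard_inter F U' hFfin hU'fin
        rw [← hSdef] at hie
        have h1 : (j + 1) * r ≤ (j + 1) * r' + (j + 1) * (ρ - s) := by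
          rw [← Nat.mul_add]
          exact Nat.mul_le_mul_left _ (by omega)
        have h2 : j * U'.ncard + j * 1 + j * (ρ - s) ≤ j * (F ∪ U').ncard := by
          rw [← Nat.mul_add, ← Nat.mul_add]
          exact Nat.mul_le_mul_left _ (by omega)
        have h3 : (j + 1) * (ρ - s) ≤ j * (ρ - s) + j := by
          rw [Nat.succ_mul]
          exact Nat.add_le_add_left (by omega) _
        linarith
    · have h𝓕'e : 𝓕' = ∅ := Finset.not_nonempty_iff_eq_empty.1 h𝓕'
      rw [h𝓕'e] at hr ⊢
      have hemp : (⋃ G ∈ (∅ : Finset (Set α)), G) = (∅ : Set α) := by simp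
      rw [hemp, Set.union_empty] at hr ⊢
      rw [hr] at hrF
      have hrρ : r = ρ := by exact_mod_cast hrF
      rw [hrρ]
      have := Nat.mul_le_mul_left j hνF
      linarith

/-- **The union of a heavy family is small**: `|⋃𝓕| ≤ ρ + (j + 1)·d − j·ν₁` (corank `d`). -/
theorem ncard_biUnion_le_of_heavy [M.Finite] {ρ ν₁ j d : ℕ} (hd : M.E.encard = M.eRank + d)
    (𝓕 : Finset (Set α))
    (hFE : ∀ F ∈ 𝓕, F ⊆ M.E) (hrk : ∀ F ∈ 𝓕, M.eRk F = ρ) (hν : ∀ F ∈ 𝓕, ρ + ν₁ ≤ F.ncard)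
    (hinter : ∀ F ∈ 𝓕, ∀ F' ∈ 𝓕, F ≠ F' → ((ρ - j : ℕ) : ℕ∞) ≤ M.eRk (F ∩ F'))
    (hsub : ∀ F ∈ 𝓕, ∀ S ⊆ F, S ≠ F → ∀ r : ℕ, M.eRk S = r → S.ncard + ρ + 1 ≤ F.ncard + r) :
    (⋃ F ∈ 𝓕, F).ncard ≤ ρ + (j + 1) * d - j * ν₁ := by
  classical
  rcases 𝓕.eq_empty_or_nonempty with h | hne
  · rw [h]
    simp
  · have hUE : (⋃ F ∈ 𝓕, F) ⊆ M.E := by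
      intro x hx
      rw [Set.mem_iUnion₂] at hx
      obtain ⟨G, hG, hxG⟩ := hx
      exact hFE G hG hxG
    obtain ⟨r, hr⟩ := exists_eRk_eq_nat (M := M) hUE
    have hinv := union_bound 𝓕 hne hFE hrk hν hinter hsub hr
    have hcap : (⋃ F ∈ 𝓕, F).ncard ≤ r + d := ncard_le_add_of_eRk_eq hUE hd hr
    have h1 : j * (⋃ F ∈ 𝓕, F).ncard ≤ j * r + j * d := by
      rw [← Nat.mul_add]
      exact Nat.mul_le_mul_left _ hcap
    have h2 : r + j * ν₁ ≤ ρ + j * d := by linarith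
    have e2 : (j + 1) * d = j * d + d := by ring
    omega

end Matroid

end PercRepro
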